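import Summits.CriticalPhenomena.CardyFormulaZ2.Theorems.CardyMagicRigidityNestingRigidityNeckZ2StrandsExact
import Literature.Probability.Percolation.ThinAnnulusCircuits
import Literature.Probability.Percolation.RadialCrossingDuality
import Literature.Probability.Percolation.InequalitiesProofs
import Literature.Probability.Percolation.FourArmGarbanDocking
import Literature.Probability.Percolation.BrickHex
import HarnessLib

/-!
# Crux `NestingRigidity`, line `pinch-resampling` (v4), stub S12: `ZFourStrandsPositive` (IV) — RSW, Reimer, translation

Crux `Summit.CriticalPhenomena.CardyFormulaZ2.Theses.CardyMagicRigidity.NestingRigidity` (stmt-CriticalPhenomena-4835),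
line `pinch-resampling` v4, stub S12; last of the four files on the input `ZFourStrandsPositive` of
`neckHookupCoarseZ2_of_inputs` (`…NeckZ2ErrorCover`; strategy in `…NeckZ2StrandsWitnesses`).  §10 `P(strandsWitness s) ≥ c₁`
(`s ≥ 64`; RSW at aspect ratio `40`, Harris, independence — template `exists_pos_le_real_fourArmTwoClusters_of_ratio`);
§11 `P(primalStray s ∪ dualStray s) ≤ 1 - c₄` (an open circuit of `A_{s+3, s+3+⌊s/8⌋}` excludes every dual crossing, a
closed dual circuit of `A_{s+6+⌊s/8⌋, 2s-2}` every primal crossing; `ThinAnnulusCircuits.lean`, independence); §12 Reimer's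
inequality (`reimer_holds`) with `zFourStrands_of_witness`: `P(ZFourStrands 0 s) ≥ c₁ c₄`; §13 invariance of
`TwoCrossingClusters` under a symmetry of the lattice and of the colour graph, translation of the boxes, and the
registered target **`zFourStrandsPositive_holds : ZFourStrandsPositive`**.
-/

noncomputable section

namespace Summit.CriticalPhenomena.CardyFormulaZ2.Cruxes.NestingRigidity.PinchResampling

open MeasureTheory Set Literature.Probability.Percolation Literature.Probability.LatticeModels SimpleGraph
open ZPinchLocality NeckCoarseZ2

namespace ZStrands

variable {ω : BondConfig (Site 2)} {s : ℕ}

/-! ## §10 RSW: the witnessed event has probability bounded below -/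

/-- **`P_{1/2}(strandsWitness s) ≥ c₁ > 0` for `s ≥ 64`** (RSW at aspect ratio `40` for the four corridors, Harris for
the two open and for the two dual ones, independence of the two halves, which read the pairs with `|x₀| ≥ s + 1`,
resp. with `0 ≤ x₀ ≤ ⌊s/8⌋`; the template is `exists_pos_le_real_fourArmTwoClusters_of_ratio`). -/
theorem exists_pos_le_real_strandsWitness :
    ∃ c₁ : ℝ, 0 < c₁ ∧ ∀ s : ℕ, 64 ≤ s → c₁ ≤ (bondPercolation (zdGraph 2) half).real (strandsWitness s) := by
  obtain ⟨c, hc0, hc⟩ := rsw_lowerBound_holds 40 (by omega)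
  refine ⟨c * c * (c * c), by positivity, fun s hs ↦ ?_⟩
  set μ := bondPercolation (zdGraph 2) half with hμ
  have hq8 : 8 ≤ s / 8 := by omega
  have hasp₁ : s ≤ 40 * (hq s + 1) - 1 := by unfold hq; omega
  have hasp₂ : s - 1 + 1 ≤ 40 * (wq s - 1 + 1) - 1 := by unfold wq; omega
  have hwq : wq s - 1 + 1 = wq s := by unfold wq; omega
  set UR := lrCrossingAt ![(s : ℤ) + 1, 0] s (hq s) with hUR
  set UL := lrCrossingAt ![-(2 * (s : ℤ) + 1), 0] s (hq s) with hUL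
  set DT := dualFaceCrossing ![0, (s : ℤ) + 1] (wq s) (s - 1) with hDT
  set DB := dualFaceCrossing ![0, -(2 * (s : ℤ))] (wq s) (s - 1) with hDB
  have hUR' : c ≤ μ.real UR := le_real_lrCrossingAt_of_rsw_ratio hc _ hasp₁
  have hUL' : c ≤ μ.real UL := le_real_lrCrossingAt_of_rsw_ratio hc _ hasp₁
  have hDT' : c ≤ μ.real DT := by
    have := le_real_dualFaceCrossing_of_rsw_ratio hc ![0, (s : ℤ) + 1] hasp₂; rwa [hwq] at this
  have hDB' : c ≤ μ.real DB := by
    have := le_real_dualFaceCrossing_of_rsw_ratio hc ![0, -(2 * (s : ℤ))] hasp₂; rwa [hwq] at this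
  have hU : c * c ≤ μ.real (UR ∩ UL) :=
    le_real_inter_of_upper hc0.le hc0.le (isUpperSet_lrCrossingAt _ _ _) (isUpperSet_lrCrossingAt _ _ _)
      (measurableSet_lrCrossingAt _ _ _) (measurableSet_lrCrossingAt _ _ _) hUR' hUL'
  have hD : c * c ≤ μ.real (DT ∩ DB) :=
    le_real_inter_of_lower hc0.le hc0.le (isLowerSet_dualFaceCrossing _ _ _) (isLowerSet_dualFaceCrossing _ _ _)
      (measurableSet_dualFaceCrossing _ _ _) (measurableSet_dualFaceCrossing _ _ _) hDT' hDB'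
  -- locality: the open corridors read pairs with `|x₀| ≥ s + 1`, the dual ones pairs with `0 ≤ x₀ ≤ wq s`
  set FU : Finset (Sym2 (Site 2)) :=
    ((rectangle s (hq s)).image (· + (![(s : ℤ) + 1, 0] : Site 2))).sym2 ∪
      ((rectangle s (hq s)).image (· + (![-(2 * (s : ℤ) + 1), 0] : Site 2))).sym2 with hFU
  set FD : Finset (Sym2 (Site 2)) :=
    dualFaceCrossingPairs ![0, (s : ℤ) + 1] (wq s) (s - 1) ∪ dualFaceCrossingPairs ![0, -(2 * (s : ℤ))] (wq s) (s - 1)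
    with hFD
  have dU : DeterminedBy (UR ∩ UL) ↑FU := by
    rw [hFU, Finset.coe_union]
    exact ((determinedBy_openCrossing_image _ _ _ _).mono subset_union_left).inter
      ((determinedBy_openCrossing_image _ _ _ _).mono subset_union_right)
  have dD : DeterminedBy (DT ∩ DB) ↑FD := by
    rw [hFD, Finset.coe_union]
    exact ((determinedBy_dualFaceCrossing _ _ _).mono subset_union_left).inter
      ((determinedBy_dualFaceCrossing _ _ _).mono subset_union_right)
  have hwqs : (wq s : ℤ) < s := by unfold wq; omega
  have hdisj : Disjoint (↑FU : Set (Sym2 (Site 2))) ↑FD := by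
    rw [Finset.disjoint_coe, Finset.disjoint_left]
    intro e heU heD
    obtain ⟨z, hz⟩ : ∃ z, z ∈ e := ⟨e.out.1, Sym2.out_fst_mem e⟩
    have hzD : 0 ≤ z 0 ∧ z 0 ≤ wq s := by
      rw [hFD, Finset.mem_union] at heD
      rcases heD with h' | h' <;>
      · have := apply_le_of_mem_dualFaceCrossingPairs h' hz
        simp only [Matrix.cons_val_zero, Matrix.cons_val_one] at this
        omega
    rw [hFU, Finset.mem_union] at heU
    rcases heU with h' | h' <;>
    · have := apply_le_of_mem_rectanglePairs h' hz
      simp only [Matrix.cons_val_zero, Matrix.cons_val_one] at this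
      omega
  have hmU : MeasurableSet (UR ∩ UL) := (measurableSet_lrCrossingAt _ _ _).inter (measurableSet_lrCrossingAt _ _ _)
  have hmD : MeasurableSet (DT ∩ DB) :=
    (measurableSet_dualFaceCrossing _ _ _).inter (measurableSet_dualFaceCrossing _ _ _)
  have hind := bondPercolation_real_inter_of_disjoint (zdGraph 2) half hdisj dU dD hmU hmD
  -- on lattice configurations the corridors give the witnesses
  have hsub : ∀ᵐ ω ∂μ, ω ∈ UR ∩ UL ∩ (DT ∩ DB) → ω ∈ strandsWitness s := by
    filter_upwards [ae_subset_edgeSet (zdGraph 2) half] with ω hω h'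
    exact ⟨⟨openWalkLR_of_lrCrossingAt hω h'.1.1, openWalkLR_of_lrCrossingAt hω h'.1.2⟩, h'.2⟩
  calc c * c * (c * c) ≤ μ.real (UR ∩ UL) * μ.real (DT ∩ DB) :=
        mul_le_mul hU hD (by positivity) measureReal_nonneg
    _ = μ.real (UR ∩ UL ∩ (DT ∩ DB)) := hind.symm
    _ ≤ μ.real (strandsWitness s) := ENNReal.toReal_mono (measure_ne_top _ _) (measure_mono_ae hsub)

/-! ## §11 RSW: the stray event has probability bounded away from one -/

/-- An open circuit of an annulus only reads the pairs of the annulus. -/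
theorem determinedBy_openCircuitInAnnulusAt_zero_pairs (a b : ℕ) :
    DeterminedBy (openCircuitInAnnulusAt 0 a b) {ε | ∀ y ∈ ε, y ∈ sqAnnulus a b} := by
  rw [determinedBy_iff]
  have key : ∀ ω ω' : BondConfig (Site 2), ω ∩ {ε | ∀ y ∈ ε, y ∈ sqAnnulus a b} = ω' ∩ {ε | ∀ y ∈ ε, y ∈ sqAnnulus a b} →
      ω ∈ openCircuitInAnnulusAt 0 a b → ω' ∈ openCircuitInAnnulusAt 0 a b := by
    rintro ω ω' h ⟨u, w, hc, hs, he, ho⟩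
    refine ⟨u, w, hc, hs, fun e he' ↦ ?_, ho⟩
    have : e ∈ ω ∩ {ε | ∀ y ∈ ε, y ∈ sqAnnulus a b} :=
      ⟨he e he', fun y hy ↦ by simpa using hs y (w.mem_support_of_mem_edges he' hy)⟩
    rw [h] at this
    exact this.1
  exact fun ω ω' h ↦ ⟨key ω ω' h, key ω' ω h.symm⟩

/-- **An open circuit of an inner sub-annulus forbids every dual crossing of the dual collar.** -/
theorem not_mem_dualStray_of_openCircuit {a b : ℕ} (ha : s + 3 ≤ a) (hab : a ≤ b) (hb : b + 1 ≤ 2 * s)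
    (h : ω ∈ openCircuitInAnnulus a b) : ω ∉ dualStray s := by
  rintro ⟨v, ⟨hvD, z, hz, hvz⟩, x, ⟨hxD, y, hy, hxy⟩, hP⟩
  obtain ⟨Q, -, hQc⟩ := exists_faceWalk_of_pathIn hP
  refine not_mem_openCircuitInAnnulus_of_dualWalk (by omega) hab Q (forall_edges_mem_dualConfig Q hQc) ?_ ?_ h
  · have h1 := mem_zDualBall_zero.1 hz
    rw [mem_box, Fin.forall_fin_two]
    rcases stepKind_of_adj hvz with ⟨h0, h1'⟩ | ⟨h0, h1'⟩ | ⟨h1', h0⟩ | ⟨h1', h0⟩ <;> omega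
  · intro hx
    rw [mem_box, Fin.forall_fin_two] at hx
    have h1 : ¬ _ := fun h' ↦ hy (mem_zDualBall_zero.2 h')
    rcases stepKind_of_adj hxy with ⟨h0, h1'⟩ | ⟨h0, h1'⟩ | ⟨h1', h0⟩ | ⟨h1', h0⟩ <;> omega

/-- **A closed dual circuit of an outer sub-annulus forbids every primal crossing of the collar** (lattice
configurations). -/
theorem not_mem_primalStray_of_dualCircuit (hs : 8 ≤ s) (hω : ω ⊆ (zdGraph 2).edgeSet) {a b : ℕ} (ha : s + 3 ≤ a)
    (hab : a ≤ b) (hb : b + 2 ≤ 2 * s) (h : ω ∈ dualCircuitInAnnulusAt 0 a b) : ω ∉ primalStray s := by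
  rintro ⟨v, hvI, x, hx, hP⟩
  obtain ⟨P, -, hPo⟩ := exists_walk_of_pathIn hω hP
  have hv := zNorm_eq_of_mem_innerLayer hvI
  have hx' := zNorm_eq_of_mem_outerLayer hx
  rw [sub_zero, zNorm] at hv hx'
  rw [dualCircuitInAnnulusAt, mem_preimage, openCircuitInAnnulusAt_zero] at h
  refine dualConfig_not_mem_openCircuitInAnnulus_of_openWalk (by omega) hab hω P hPo ?_ ?_ h
  · rw [mem_box, Fin.forall_fin_two]
    simp only [Pi.sub_apply, one_apply_site]
    have h0 : |v 0| ≤ s + 1 := hv ▸ le_max_left _ _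
    have h1 : |v 1| ≤ s + 1 := hv ▸ le_max_right _ _
    rw [abs_le] at h0 h1; omega
  · intro hb'
    rw [mem_box, Fin.forall_fin_two] at hb'
    simp only [Pi.sub_apply, one_apply_site] at hb'
    rcases max_choice |x 0| |x 1| with hm | hm <;> rw [hm, abs_eq (by positivity)] at hx' <;> omega

/-- **`P_{1/2}(stray) ≤ 1 - c₄` for `s ≥ 64`**: an open circuit of `A_{s+3, s+3+⌊s/8⌋}` and a closed dual circuit of
`A_{s+6+⌊s/8⌋, 2s-2}` occur together with probability `≥ ρ²` (RSW circuits at aspect ratio `40`,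
`ThinAnnulusCircuits.lean`; independence of the two annuli, which read disjoint sets of pairs since every pair shares a
vertex with its dual pair), and exclude every stray crossing. -/
theorem exists_pos_real_stray_le :
    ∃ c₄ : ℝ, 0 < c₄ ∧ ∀ s : ℕ, 64 ≤ s →
      (bondPercolation (zdGraph 2) half).real (primalStray s ∪ dualStray s) ≤ 1 - c₄ := by
  obtain ⟨ρ₁, hρ₁, h₁⟩ := exists_pos_le_real_openCircuitInAnnulus (k := 40) (by omega)
  obtain ⟨ρ₂, hρ₂, h₂⟩ := exists_pos_le_real_dualCircuitInAnnulusAt_half (k := 40) (by omega)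
  refine ⟨ρ₁ * ρ₂, by positivity, fun s hs ↦ ?_⟩
  classical
  set μ := bondPercolation (zdGraph 2) half with hμ
  set q := s / 8 with hqdef
  have hq8 : 8 ≤ q := by omega
  set OC := openCircuitInAnnulus (s + 3) (s + 3 + q) with hOC
  set DC := dualCircuitInAnnulusAt 0 (s + 6 + q) (2 * s - 2) with hDC
  have hOC : ρ₁ ≤ μ.real OC := h₁ _ _ (by omega) (by omega) (by omega)
  have hDC : ρ₂ ≤ μ.real DC := h₂ 0 _ _ (by omega) (by omega) (by omega)
  -- independence: disjoint determining pair sets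
  have dO := determinedBy_openCircuitInAnnulusAt_zero_pairs (s + 3) (s + 3 + q)
  rw [openCircuitInAnnulusAt_zero] at dO
  have dD : DeterminedBy DC (dualEdge ⁻¹' {ε | ∀ y ∈ ε, y ∈ sqAnnulus (s + 6 + q) (2 * s - 2)}) :=
    (determinedBy_openCircuitInAnnulusAt_zero_pairs _ _).preimage_dualConfig
  have hdisj : Disjoint {ε : Sym2 (Site 2) | ∀ y ∈ ε, y ∈ sqAnnulus (s + 3) (s + 3 + q)}
      (dualEdge ⁻¹' {ε | ∀ y ∈ ε, y ∈ sqAnnulus (s + 6 + q) (2 * s - 2)}) := by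
    rw [Set.disjoint_left]
    intro ε h1 h2
    obtain ⟨v, hv, hv'⟩ := exists_mem_mem_dualEdge ε
    have a1 := (mem_sqAnnulus_iff (by omega)).1 (h1 v hv)
    have a2 := (mem_sqAnnulus_iff (by omega)).1 (h2 v hv')
    rw [Fin.forall_fin_two, Fin.exists_fin_two] at a1 a2
    omega
  have hmO : MeasurableSet OC := measurableSet_openCircuitInAnnulus _ _
  have hmDC : MeasurableSet DC := measurableSet_dualCircuitInAnnulusAt _ _ _
  have hind := bondPercolation_real_inter_of_disjoint (zdGraph 2) half hdisj dO dD hmO hmDC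
  -- the two circuits exclude the stray crossings (on lattice configurations)
  obtain ⟨F, hF⟩ := isLocalEvent_stray s
  have hmS : MeasurableSet (primalStray s ∪ dualStray s) := hF.measurableSet_of_finset
  have hsub : ∀ᵐ ω ∂μ, ω ∈ OC ∩ DC → ω ∈ (primalStray s ∪ dualStray s)ᶜ := by
    filter_upwards [ae_subset_edgeSet (zdGraph 2) half] with ω hω h'
    rintro (h | h)
    · exact not_mem_primalStray_of_dualCircuit (by omega) hω (by omega) (by omega) (by omega) h'.2 h
    · exact not_mem_dualStray_of_openCircuit (by omega) (by omega) (by omega) h'.1 h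
  have key : ρ₁ * ρ₂ ≤ μ.real (primalStray s ∪ dualStray s)ᶜ :=
    calc ρ₁ * ρ₂ ≤ μ.real OC * μ.real DC := mul_le_mul hOC hDC hρ₂.le measureReal_nonneg
      _ = μ.real (OC ∩ DC) := hind.symm
      _ ≤ μ.real (primalStray s ∪ dualStray s)ᶜ := ENNReal.toReal_mono (measure_ne_top _ _) (measure_mono_ae hsub)
  rw [probReal_compl_eq_one_sub hmS] at key
  linarith

/-! ## §12 Reimer: positivity of the selection event at the origin -/

/-- **`P_{1/2}(ZFourStrands 0 s) ≥ c₀ > 0` for `s ≥ 64`.**  By `zFourStrands_of_witness`, a.s.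
`strandsWitness s ∖ (strandsWitness s □ stray) ⊆ ZFourStrands 0 s`; Reimer's inequality (`reimer_holds`, both events
local) gives `P(strandsWitness □ stray) ≤ P(strandsWitness) · P(stray) ≤ (1 - c₄) P(strandsWitness)`, whence
`P(ZFourStrands 0 s) ≥ c₄ P(strandsWitness s) ≥ c₄ c₁`. -/
theorem exists_pos_le_real_zFourStrands_zero :
    ∃ s₀ : ℕ, ∃ c₀ : ℝ, 0 < c₀ ∧ ∀ s : ℕ, s₀ ≤ s → c₀ ≤ (bondPercolation (zdGraph 2) half).real (ZFourStrands 0 s) := by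
  obtain ⟨c₁, hc₁, h₁⟩ := exists_pos_le_real_strandsWitness
  obtain ⟨c₄, hc₄, h₄⟩ := exists_pos_real_stray_le
  refine ⟨64, c₁ * c₄, by positivity, fun s hs ↦ ?_⟩
  classical
  set μ := bondPercolation (zdGraph 2) half with hμ
  set W := strandsWitness s with hWdef
  set Z := primalStray s ∪ dualStray s with hZdef
  have hWl : IsLocalEvent W := isLocalEvent_strandsWitness s
  have hZl : IsLocalEvent Z := isLocalEvent_stray s
  obtain ⟨FW, hFW⟩ := hWl
  obtain ⟨FZ, hFZ⟩ := hZl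
  have hmWZ : MeasurableSet (disjointOccurrence W Z) :=
    DeterminedBy.measurableSet_of_finset (F := FW ∪ FZ)
      ((hFW.mono (by rw [Finset.coe_union]; exact subset_union_left)).disjointOccurrence
        (hFZ.mono (by rw [Finset.coe_union]; exact subset_union_right)))
  have hReimer : μ.real (disjointOccurrence W Z) ≤ μ.real W * μ.real Z :=
    reimer_holds (zdGraph 2) half ⟨FW, hFW⟩ ⟨FZ, hFZ⟩
  have hsub : ∀ᵐ ω ∂μ, ω ∈ W \ disjointOccurrence W Z → ω ∈ ZFourStrands 0 s := by
    filter_upwards [ae_subset_edgeSet (zdGraph 2) half] with ω hω h'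
    exact zFourStrands_of_witness ω s (by omega) hω h'.1 h'.2
  have hcov : W ⊆ W \ disjointOccurrence W Z ∪ disjointOccurrence W Z := fun ω hω ↦ by
    by_cases h : ω ∈ disjointOccurrence W Z
    exacts [Or.inr h, Or.inl ⟨hω, h⟩]
  have hdiff : μ.real W ≤ μ.real (W \ disjointOccurrence W Z) + μ.real (disjointOccurrence W Z) :=
    (measureReal_mono hcov (measure_ne_top _ _)).trans (measureReal_union_le _ _)
  have hW := h₁ s hs
  have hZ := h₄ s hs
  have hWnn : 0 ≤ μ.real W := measureReal_nonneg
  calc c₁ * c₄ ≤ μ.real W * (1 - μ.real Z) := mul_le_mul hW (by linarith) hc₄.le hWnn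
    _ ≤ μ.real W - μ.real (disjointOccurrence W Z) := by nlinarith
    _ ≤ μ.real (W \ disjointOccurrence W Z) := by linarith
    _ ≤ μ.real (ZFourStrands 0 s) := ENNReal.toReal_mono (measure_ne_top _ _) (measure_mono_ae hsub)

/-! ## §13 Translation invariance and the theorem -/

section Transport

variable {V : Type*}

variable {G H H' : SimpleGraph V} (e : V ≃ V) (hG : ∀ a b, G.Adj (e a) (e b) ↔ G.Adj a b)
  (hH : ∀ a b, H'.Adj (e a) (e b) ↔ H.Adj a b)
include hH

/-- `PathIn` is invariant under a symmetry of the colour graph. -/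
theorem pathIn_equiv_iff {S : Set V} {a b : V} : PathIn H' (e '' S) (e a) (e b) ↔ PathIn H S a b := by
  refine ⟨fun h ↦ ?_, PathIn.map_adj e fun a b hab ↦ (hH a b).2 hab⟩
  have h' := PathIn.map_adj (G := H') (G' := H) e.symm (fun a b hab ↦ ?_) h
  · simpa [Set.image_image] using h'
  · rw [← hH, e.apply_symm_apply, e.apply_symm_apply]; exact hab

include hG
omit hH

/-- The inner layer is covariant under a symmetry of the lattice. -/
theorem mem_innerLayer_equiv_iff {I O : Set V} {a : V} : e a ∈ innerLayer G (e '' I) (e '' O) ↔ a ∈ innerLayer G I O := by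
  simp only [innerLayer, mem_setOf_eq, mem_sdiff, e.injective.mem_set_image, Set.exists_mem_image, hG]

/-- The outer layer is covariant under a symmetry of the lattice. -/
theorem mem_outerLayer_equiv_iff {I O : Set V} {a : V} : e a ∈ outerLayer G (e '' I) (e '' O) ↔ a ∈ outerLayer G I O := by
  simp only [outerLayer, mem_setOf_eq, mem_sdiff, e.injective.mem_set_image]
  refine and_congr_right fun _ ↦ ⟨?_, ?_⟩
  · rintro ⟨w, hw, hadj⟩
    refine ⟨e.symm w, fun h ↦ hw ?_, ?_⟩
    · rw [← e.apply_symm_apply w]; exact mem_image_of_mem e h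
    · rw [← hG, e.apply_symm_apply]; exact hadj
  · rintro ⟨w, hw, hadj⟩
    exact ⟨e w, fun h ↦ hw (e.injective.mem_set_image.1 h), (hG _ _).2 hadj⟩

include hH

/-- `IsCrossing` is invariant under a common symmetry of the lattice and of the colour graph. -/
theorem isCrossing_equiv_iff {I O : Set V} {a : V} :
    IsCrossing G H' (e '' I) (e '' O) (e a) ↔ IsCrossing G H I O a := by
  unfold IsCrossing
  rw [mem_innerLayer_equiv_iff e hG, ← Set.image_sdiff e.injective]
  refine and_congr_right fun _ ↦ ⟨?_, ?_⟩
  · rintro ⟨w, hw, hP⟩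
    refine ⟨e.symm w, (mem_outerLayer_equiv_iff e hG).1 (by rw [e.apply_symm_apply]; exact hw), ?_⟩
    rw [← pathIn_equiv_iff e hH, e.apply_symm_apply]; exact hP
  · rintro ⟨w, hw, hP⟩
    exact ⟨e w, (mem_outerLayer_equiv_iff e hG).2 hw, (pathIn_equiv_iff e hH).2 hP⟩

/-- `TwoCrossingClusters` is invariant under a common symmetry of the lattice and of the colour graph. -/
theorem twoCrossingClusters_equiv_iff {I O : Set V} :
    TwoCrossingClusters G H' (e '' I) (e '' O) ↔ TwoCrossingClusters G H I O := by
  unfold TwoCrossingClusters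
  rw [← Set.image_sdiff e.injective]
  refine and_congr ⟨?_, ?_⟩ ⟨fun h v₁ v₂ v₃ h₁ h₂ h₃ ↦ ?_, fun h w₁ w₂ w₃ h₁ h₂ h₃ ↦ ?_⟩
  · rintro ⟨w₁, w₂, h₁, h₂, hn⟩
    obtain ⟨v₁, rfl⟩ := e.surjective w₁
    obtain ⟨v₂, rfl⟩ := e.surjective w₂
    rw [isCrossing_equiv_iff e hG hH] at h₁ h₂
    exact ⟨v₁, v₂, h₁, h₂, fun hP ↦ hn ((pathIn_equiv_iff e hH).2 hP)⟩
  · rintro ⟨v₁, v₂, h₁, h₂, hn⟩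
    refine ⟨e v₁, e v₂, ?_, ?_, fun hP ↦ hn ((pathIn_equiv_iff e hH).1 hP)⟩ <;>
      rwa [isCrossing_equiv_iff e hG hH]
  · have := h (e v₁) (e v₂) (e v₃) (by rwa [isCrossing_equiv_iff e hG hH])
      (by rwa [isCrossing_equiv_iff e hG hH])
      (by rwa [isCrossing_equiv_iff e hG hH])
    simpa only [pathIn_equiv_iff e hH] using this
  · obtain ⟨v₁, rfl⟩ := e.surjective w₁
    obtain ⟨v₂, rfl⟩ := e.surjective w₂
    obtain ⟨v₃, rfl⟩ := e.surjective w₃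
    rw [isCrossing_equiv_iff e hG hH] at h₁ h₂ h₃
    simpa only [pathIn_equiv_iff e hH] using h v₁ v₂ v₃ h₁ h₂ h₃

end Transport

/-- Translating the centre translates the primal box. -/
theorem zBall_add (c v : Site 2) (n : ℕ) : zBall (c + v) n = Site.shift v '' zBall c n := by
  ext y
  simp only [zBall, mem_setOf_eq, mem_image, Site.shift_apply]
  constructor
  · intro h; exact ⟨y - v, by rwa [show y - v - c = y - (c + v) by abel], sub_add_cancel y v⟩
  · rintro ⟨a, ha, rfl⟩; rwa [add_sub_add_right_eq_sub]

/-- Translating the centre translates the dual box. -/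
theorem zDualBall_add (c v : Site 2) (n : ℕ) : zDualBall (c + v) n = Site.shift v '' zDualBall c n := by
  ext y
  simp only [zDualBall, mem_setOf_eq, mem_image, Site.shift_apply]
  constructor
  · intro h; exact ⟨y - v, by rwa [show y - v - c = y - (c + v) by abel], sub_add_cancel y v⟩
  · rintro ⟨a, ha, rfl⟩; rwa [add_sub_add_right_eq_sub]

/-- **Transport of the selection event by a translation.** -/
theorem relabel_shift_mem_zFourStrands {c v : Site 2} {ω : BondConfig (Site 2)} (h : ω ∈ ZFourStrands c s) :
    BondConfig.relabel (sym2Equiv (Site.shift v)) ω ∈ ZFourStrands (c + v) s := by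
  obtain ⟨h1, h2⟩ := h
  have hG : ∀ a b, (zdGraph 2).Adj (Site.shift v a) (Site.shift v b) ↔ (zdGraph 2).Adj a b := zdGraph_adj_shift_iff v
  refine ⟨?_, ?_⟩
  · rw [zBall_add, zBall_add]
    exact (twoCrossingClusters_equiv_iff (Site.shift v) hG fun a b ↦ openGraph_relabel_adj_iff (Site.shift v) ω a b).2 h1
  · rw [zDualBall_add, zDualBall_add, dualConfig_relabel_shift]
    exact (twoCrossingClusters_equiv_iff (Site.shift v) hG fun a b ↦
      openGraph_relabel_adj_iff (Site.shift v) (dualConfig ω) a b).2 h2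

/-- **The selection event about `x` as a translate of the event about the origin.** -/
theorem zFourStrands_eq_preimage (x : Site 2) (s : ℕ) :
    ZFourStrands x s = BondConfig.relabel (sym2Equiv (Site.shift (-x))) ⁻¹' ZFourStrands 0 s := by
  ext ω
  rw [mem_preimage]
  constructor
  · intro h
    have := relabel_shift_mem_zFourStrands (v := -x) h
    rwa [add_neg_cancel] at this
  · intro h
    have := relabel_shift_mem_zFourStrands (v := x) h
    rw [zero_add] at this
    rwa [show BondConfig.relabel (sym2Equiv (Site.shift x)) (BondConfig.relabel (sym2Equiv (Site.shift (-x))) ω) = ω by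
      simpa using relabel_shift_neg_relabel_shift (-x) ω] at this

/-- **Translation invariance of the probability of the selection event.** -/
theorem real_zFourStrands_eq (x : Site 2) (s : ℕ) :
    (bondPercolation (zdGraph 2) half).real (ZFourStrands x s) = (bondPercolation (zdGraph 2) half).real (ZFourStrands 0 s) := by
  rw [zFourStrands_eq_preimage, bondPercolation_real_preimage_shift]

end ZStrands

/-- **`ZFourStrandsPositive` — RSW positivity of the S12 selection event at ratio `2`** (input of
`neckHookupCoarseZ2_of_inputs`, `…NeckZ2ErrorCover`; registered anchor): exactly two primal-open crossing clusters
of `Λ_{2s}(x) ∖ Λ_s(x)` and exactly two dual-open crossing clusters of the dual collar occur with probability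
`≥ c₀ > 0`, uniformly in the centre `x` and in `s ≥ s₀` (`s₀ = 64`). -/
theorem zFourStrandsPositive_holds : ZFourStrandsPositive := by
  obtain ⟨s₀, c₀, hc₀, h⟩ := ZStrands.exists_pos_le_real_zFourStrands_zero
  exact ⟨s₀, c₀, hc₀, fun x s hs ↦ by rw [ZStrands.real_zFourStrands_eq]; exact h s hs⟩

end Summit.CriticalPhenomena.CardyFormulaZ2.Cruxes.NestingRigidity.PinchResampling

end
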